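import Summits.QuantumFields.YangMills.Theorems.CurvatureBoostCovariance.Negative.Unbundled
import Summits.QuantumFields.YangMills.Theorems.NPointIsotropy.Negative.NPointRegularJunk

/-!
# Tensor density (du Bois-Reymond for appended tensor products) — stub `stub_tensorDensity`

Line `boosts-inherit-mirrors` of crux `MirrorModularBoosts.CurvatureBoostCovariance` (stmt-QuantumFields-9663),
Stub 6a of the registered skeleton `Cruxes/CurvatureBoostCovariance/Lines/boosts_inherit_mirrors.lean`.

Statement.  Let `U ⊆ (ℝ⁴)ⁿ`, `V ⊆ (ℝ⁴)ᵐ` be open and `D` locally integrable on the appended product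
`U ×' V = {x | (xᵢ)_{i<n} ∈ U ∧ (x_{n+j})_{j<m} ∈ V}`.  If `∫ D · H = 0` for every appended tensor product
`H = Φ ⊗ Ψ` (`IsAppendTensorOf`) of Schwartz functions with compact supports in `U`, `V`, then `∫ D · K = 0` for
every Schwartz `K` compactly supported in `U ×' V`.

Proof (pure real analysis).  Project `tsupport K` to the two factors (compact images `⊆ U`, `⊆ V`) and pick smooth
cut-offs `χ₁, χ₂ : _ → [0,1]`, `≡ 1` on the projections, compactly supported in `U`, `V`
(`exists_contMDiff_support_eq_eq_one_iff` on a thickening).  On the compact product `X = tsupport χ₁ ×' tsupport χ₂`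
the real subalgebra of `C((ℝ⁴)ⁿ⁺ᵐ, ℝ)` generated by tensors `Φ ⊗ Ψ` of smooth real functions separates points, so by
the (non-compact-domain form of the) Stone–Weierstrass theorem
`ContinuousMap.exists_mem_subalgebra_near_continuous_of_isCompact_of_separatesPoints` it approximates `re K` and
`im K` uniformly on `X`.  The generated subalgebra is the linear span of such tensors (they form a monoid), and each
cut-off tensor `(χ₁Φ) ⊗ (χ₂Ψ)` is an admissible Schwartz tensor, killed by hypothesis; hence `∫ D · (χ₁⊗χ₂) · a = 0`
for every `a` in the subalgebra.  Since `K = (χ₁ ⊗ χ₂) · K` and `D` is integrable on `X`, the elementary bound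
`‖∫ D · K‖ ≤ 2ε ∫_X ‖D‖` for every `ε > 0` gives `∫ D · K = 0`.  No Fubini, no sequences; the degenerate cases
`n = 0` or `m = 0` need no separate treatment.

References: Stone–Weierstrass (Mathlib `Topology/ContinuousMap/StoneWeierstrass`), smooth Urysohn
(Mathlib `Geometry/Manifold/PartitionOfUnity`).
-/

noncomputable section

-- tree-known workaround (kept in every landed `Negative/*.lean` file):
attribute [-instance] SimplexCategory.instFintypeToTypeOrderHomFinHAddNatLenOfNat

namespace Summit.QuantumFields.YangMills.Theorems.CurvatureBoostCovariance.BoostsInheritMirrors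

open scoped BigOperators SchwartzMap Manifold ContDiff
open MeasureTheory Filter Topology
open Literature.MathematicalPhysics.QuantumLattice Literature.MathematicalPhysics.AQFT
  Literature.MathematicalPhysics.QuantumFieldTheory
open Summit.QuantumFields.YangMills.Theorems.NPointIsotropy.Negative (E4)

/-- Smooth Urysohn cut-off: a compact `C` inside an open `W` of a finite-dimensional real normed space admits a
smooth `χ : P → [0,1]`, compactly supported inside `W`, with `χ = 1` on `C`. -/
theorem exists_smooth_cutoff {P : Type*} [NormedAddCommGroup P] [NormedSpace ℝ P] [FiniteDimensional ℝ P]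
    {C W : Set P} (hC : IsCompact C) (hW : IsOpen W) (hCW : C ⊆ W) :
    ∃ χ : P → ℝ, ContDiff ℝ ∞ χ ∧ HasCompactSupport χ ∧ tsupport χ ⊆ W ∧
      (∀ x ∈ C, χ x = 1) ∧ ∀ x, χ x ∈ Set.Icc (0 : ℝ) 1 := by
  obtain ⟨δ, hδ, hδW⟩ := hC.exists_cthickening_subset_open hW hCW
  obtain ⟨g, g_smooth, g_range, g_supp, hg⟩ :=
    exists_contMDiff_support_eq_eq_one_iff 𝓘(ℝ, P) (n := (⊤ : ℕ∞)) Metric.isOpen_thickening hC.isClosed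
      (Metric.self_subset_thickening hδ C)
  have htsupp : tsupport g ⊆ Metric.cthickening δ C := by
    rw [tsupport, g_supp]
    exact Metric.closure_thickening_subset_cthickening δ C
  exact ⟨g, g_smooth.contDiff, IsCompact.of_isClosed_subset hC.cthickening (isClosed_tsupport g) htsupp,
    htsupp.trans hδW, fun x hx => (hg x).1 hx, fun x => g_range ⟨x, rfl⟩⟩

/-- A product `D · G` with `D` integrable on a compact `X` and `G` continuous and vanishing off `X` is
integrable. -/
theorem integrable_mul_of_eq_zero_off {P : Type*} [NormedAddCommGroup P] [NormedSpace ℝ P]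
    [FiniteDimensional ℝ P] [MeasurableSpace P] [BorelSpace P] {μ : Measure P} {D G : P → ℂ} {X : Set P}
    (hDX : IntegrableOn D X μ) (hXc : IsCompact X) (hG : Continuous G) (hG0 : ∀ x ∉ X, G x = 0) :
    Integrable (fun x => D x * G x) μ :=
  (hDX.mul_continuousOn_of_subset hG.continuousOn hXc.measurableSet hXc subset_rfl)
    |>.integrable_of_forall_notMem_eq_zero fun x hx => by simp [hG0 x hx]

/-- A smooth compactly supported real function, complexified, is a Schwartz test function with the same
values and no larger support. -/
theorem exists_schwartz_ofReal {P : Type*} [NormedAddCommGroup P] [NormedSpace ℝ P] {f : P → ℝ}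
    (hf : ContDiff ℝ ∞ f) (hfc : HasCompactSupport f) :
    ∃ F : 𝓢(P, ℂ), (∀ x, F x = (f x : ℂ)) ∧ HasCompactSupport (F : P → ℂ) ∧
      tsupport (F : P → ℂ) ⊆ tsupport f := by
  have h1 : HasCompactSupport fun x => ((f x : ℝ) : ℂ) := hfc.comp_left Complex.ofReal_zero
  have h2 : ContDiff ℝ ∞ fun x => ((f x : ℝ) : ℂ) := Complex.ofRealCLM.contDiff.comp hf
  exact ⟨h1.toSchwartzMap h2, fun _ => rfl, h1,
    tsupport_comp_subset (g := fun r : ℝ => ((r : ℝ) : ℂ)) Complex.ofReal_zero f⟩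

/-- **Stub 6a — tensor density (du Bois-Reymond for appended tensor products).**  If a locally integrable `D`
on the appended product `U ×' V` of two open sets integrates to zero against every appended tensor product
`Φ ⊗ Ψ` of Schwartz functions compactly supported in `U`, `V`, then it integrates to zero against every Schwartz
function compactly supported in `U ×' V`.  Proof: smooth cut-offs + Stone–Weierstrass on a compact product
neighbourhood of `tsupport K` + the elementary `L¹` bound (see the module docstring). -/
theorem stub_tensorDensity :
    open Literature.MathematicalPhysics.QuantumLattice Literature.MathematicalPhysics.AQFT
      Literature.MathematicalPhysics.QuantumFieldTheory
      Summit.QuantumFields.YangMills.Theorems.CurvatureBoostCovariance.Negative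
      Summit.QuantumFields.YangMills.Theorems.NPointIsotropy.Negative in
    ∀ (n m : ℕ) (U : Set (Fin n → E4)) (V : Set (Fin m → E4)), IsOpen U → IsOpen V →
      ∀ D : (Fin (n + m) → E4) → ℂ,
        MeasureTheory.LocallyIntegrableOn D
          {x | (fun i => x (Fin.castAdd m i)) ∈ U ∧ (fun j => x (Fin.natAdd n j)) ∈ V} →
        (∀ (Φ : SchwartzMap (Fin n → E4) ℂ) (Ψ : SchwartzMap (Fin m → E4) ℂ),
          HasCompactSupport (Φ : (Fin n → E4) → ℂ) → tsupport (Φ : (Fin n → E4) → ℂ) ⊆ U →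
          HasCompactSupport (Ψ : (Fin m → E4) → ℂ) → tsupport (Ψ : (Fin m → E4) → ℂ) ⊆ V →
          ∀ H : SchwartzMap (Fin (n + m) → E4) ℂ, IsAppendTensorOf H Φ Ψ →
            ∫ x : Fin (n + m) → E4, D x * H x = 0) →
        ∀ K : SchwartzMap (Fin (n + m) → E4) ℂ, HasCompactSupport (K : (Fin (n + m) → E4) → ℂ) →
          tsupport (K : (Fin (n + m) → E4) → ℂ) ⊆
            {x | (fun i => x (Fin.castAdd m i)) ∈ U ∧ (fun j => x (Fin.natAdd n j)) ∈ V} →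
          ∫ x : Fin (n + m) → E4, D x * K x = 0 := by
  intro n m U V hU hV D hD hkill K hKc hKs
  -- the two projections
  have hπ₁ : Continuous fun (x : Fin (n + m) → E4) (i : Fin n) => x (Fin.castAdd m i) := by fun_prop
  have hπ₂ : Continuous fun (x : Fin (n + m) → E4) (j : Fin m) => x (Fin.natAdd n j) := by fun_prop
  -- smooth cut-offs `≡ 1` on the two (compact) projections of `tsupport K`
  obtain ⟨χ₁, hχ₁d, hχ₁c, hχ₁U, hχ₁K, hχ₁01⟩ := exists_smooth_cutoff (hKc.image hπ₁) hU
    (by rintro _ ⟨x, hx, rfl⟩; exact (hKs hx).1)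
  obtain ⟨χ₂, hχ₂d, hχ₂c, hχ₂V, hχ₂K, hχ₂01⟩ := exists_smooth_cutoff (hKc.image hπ₂) hV
    (by rintro _ ⟨x, hx, rfl⟩; exact (hKs hx).2)
  have hχ₁cont : Continuous χ₁ := hχ₁d.continuous
  have hχ₂cont : Continuous χ₂ := hχ₂d.continuous
  -- the compact product neighbourhood `X` of `tsupport K`
  set X : Set (Fin (n + m) → E4) := {x | (fun i => x (Fin.castAdd m i)) ∈ tsupport χ₁ ∧
    (fun j => x (Fin.natAdd n j)) ∈ tsupport χ₂} with hXdef
  have hXc : IsCompact X := by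
    have hXcl : IsClosed X :=
      ((isClosed_tsupport χ₁).preimage hπ₁).inter ((isClosed_tsupport χ₂).preimage hπ₂)
    refine ((hχ₁c.isCompact.prod hχ₂c.isCompact).image (Fin.continuous_append n m)).of_isClosed_subset
      hXcl fun x hx => ⟨(_, _), ⟨hx.1, hx.2⟩, Fin.append_castAdd_natAdd⟩
  have hXS : X ⊆ {x | (fun i => x (Fin.castAdd m i)) ∈ U ∧ (fun j => x (Fin.natAdd n j)) ∈ V} :=
    fun x hx => ⟨hχ₁U hx.1, hχ₂V hx.2⟩
  have hDX : IntegrableOn D X := hD.integrableOn_compact_subset hXS hXc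
  -- the complex cut-off tensor `χ = χ₁ ⊗ χ₂`
  set χ : (Fin (n + m) → E4) → ℂ := fun x =>
    ((χ₁ (fun i => x (Fin.castAdd m i)) : ℝ) : ℂ) * ((χ₂ (fun j => x (Fin.natAdd n j)) : ℝ) : ℂ) with hχdef
  have hχcont : Continuous χ := by
    simp only [hχdef]
    fun_prop
  have hχ0 : ∀ x ∉ X, χ x = 0 := by
    intro x hx
    simp only [hXdef, Set.mem_setOf_eq, not_and_or] at hx
    rcases hx with hx | hx
    · simp [hχdef, image_eq_zero_of_notMem_tsupport hx]
    · simp [hχdef, image_eq_zero_of_notMem_tsupport hx]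
  have hχ1 : ∀ x, ‖χ x‖ ≤ 1 := by
    intro x
    simp only [hχdef, norm_mul, Complex.norm_real, Real.norm_eq_abs]
    rw [abs_of_nonneg (hχ₁01 _).1, abs_of_nonneg (hχ₂01 _).1]
    exact mul_le_one₀ (hχ₁01 _).2 (hχ₂01 _).1 (hχ₂01 _).2
  have hχK : ∀ x, χ x * K x = K x := by
    intro x
    by_cases hx : K x = 0
    · rw [hx, mul_zero]
    · have hxs : x ∈ tsupport (K : (Fin (n + m) → E4) → ℂ) := subset_tsupport _ hx
      have h1 : χ₁ (fun i => x (Fin.castAdd m i)) = 1 := hχ₁K _ ⟨x, hxs, rfl⟩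
      have h2 : χ₂ (fun j => x (Fin.natAdd n j)) = 1 := hχ₂K _ ⟨x, hxs, rfl⟩
      simp [hχdef, h1, h2]
  have hKX : ∀ x ∉ X, K x = 0 := by
    intro x hx
    by_contra hKx
    have hxs : x ∈ tsupport (K : (Fin (n + m) → E4) → ℂ) := subset_tsupport _ hKx
    refine hx ⟨subset_tsupport _ ?_, subset_tsupport _ ?_⟩
    · rw [Function.mem_support, hχ₁K _ ⟨x, hxs, rfl⟩]; exact one_ne_zero
    · rw [Function.mem_support, hχ₂K _ ⟨x, hxs, rfl⟩]; exact one_ne_zero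
  -- integrability of `D · G` for `G` continuous (the cut-off kills everything off `X`)
  have hint : ∀ g : (Fin (n + m) → E4) → ℂ, Continuous g →
      Integrable (fun x => D x * (χ x * g x)) := fun g hg =>
    integrable_mul_of_eq_zero_off hDX hXc (hχcont.mul hg) fun x hx => by rw [hχ0 x hx, zero_mul]
  have hKint : Integrable (fun x => D x * K x) :=
    integrable_mul_of_eq_zero_off hDX hXc K.continuous hKX
  -- the monoid `T` of smooth real tensors `Φ ⊗ Ψ`, as elements of `C(_, ℝ)`
  set T : Set C(Fin (n + m) → E4, ℝ) := {f | ∃ (Φ : (Fin n → E4) → ℝ) (Ψ : (Fin m → E4) → ℝ),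
    ContDiff ℝ ∞ Φ ∧ ContDiff ℝ ∞ Ψ ∧
      ∀ x, f x = Φ (fun i => x (Fin.castAdd m i)) * Ψ (fun j => x (Fin.natAdd n j))} with hTdef
  have hT1 : (1 : C(Fin (n + m) → E4, ℝ)) ∈ T :=
    ⟨fun _ => 1, fun _ => 1, contDiff_const, contDiff_const, fun x => by simp⟩
  have hTmul : ∀ f ∈ T, ∀ g ∈ T, f * g ∈ T := by
    rintro f ⟨Φ, Ψ, hΦ, hΨ, hf⟩ g ⟨Φ', Ψ', hΦ', hΨ', hg⟩
    exact ⟨fun y => Φ y * Φ' y, fun z => Ψ z * Ψ' z, hΦ.mul hΦ', hΨ.mul hΨ', fun x => by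
      rw [ContinuousMap.mul_apply, hf x, hg x]; ring⟩
  have hclT : ∀ f ∈ Submonoid.closure T, f ∈ T := fun f hf =>
    Submonoid.closure_induction (fun _ h => h) hT1 (fun f g _ _ hf hg => hTmul f hf g hg) hf
  -- the generated subalgebra separates points (smooth tensors `‖xₖ - c‖² ⊗ 1`, `1 ⊗ ‖xₖ - c‖²`)
  have hsep : (Algebra.adjoin ℝ T).SeparatesPoints := by
    intro x y hxy
    obtain ⟨k, hk⟩ := Function.ne_iff.1 hxy
    induction k using Fin.addCases with
    | left i =>
      refine ⟨_, ⟨⟨fun z => ‖z (Fin.castAdd m i) - x (Fin.castAdd m i)‖ ^ 2, by fun_prop⟩,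
        Algebra.subset_adjoin ⟨fun w => ‖w i - x (Fin.castAdd m i)‖ ^ 2, fun _ => 1,
          ((contDiff_apply ℝ E4 i).sub contDiff_const).norm_sq ℝ, contDiff_const, fun z => by simp⟩,
        rfl⟩, ?_⟩
      show ‖x (Fin.castAdd m i) - x (Fin.castAdd m i)‖ ^ 2 ≠ ‖y (Fin.castAdd m i) - x (Fin.castAdd m i)‖ ^ 2
      rw [sub_self, norm_zero, zero_pow two_ne_zero, ne_eq, eq_comm, pow_eq_zero_iff two_ne_zero, norm_eq_zero,
        sub_eq_zero]
      exact fun h => hk h.symm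
    | right j =>
      refine ⟨_, ⟨⟨fun z => ‖z (Fin.natAdd n j) - x (Fin.natAdd n j)‖ ^ 2, by fun_prop⟩,
        Algebra.subset_adjoin ⟨fun _ => 1, fun w => ‖w j - x (Fin.natAdd n j)‖ ^ 2, contDiff_const,
          ((contDiff_apply ℝ E4 j).sub contDiff_const).norm_sq ℝ, fun z => by simp⟩,
        rfl⟩, ?_⟩
      show ‖x (Fin.natAdd n j) - x (Fin.natAdd n j)‖ ^ 2 ≠ ‖y (Fin.natAdd n j) - x (Fin.natAdd n j)‖ ^ 2
      rw [sub_self, norm_zero, zero_pow two_ne_zero, ne_eq, eq_comm, pow_eq_zero_iff two_ne_zero, norm_eq_zero,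
        sub_eq_zero]
      exact fun h => hk h.symm
  -- every cut-off tensor `(χ₁Φ) ⊗ (χ₂Ψ)` is an admissible Schwartz tensor, hence killed
  have hQT : ∀ f ∈ T, ∫ x, D x * (χ x * ((f x : ℝ) : ℂ)) = 0 := by
    rintro f ⟨Φ, Ψ, hΦ, hΨ, hf⟩
    obtain ⟨F₁, hF₁, hF₁c, hF₁t⟩ := exists_schwartz_ofReal (hχ₁d.mul hΦ) (hχ₁c.mul_right (f' := Φ))
    obtain ⟨F₂, hF₂, hF₂c, hF₂t⟩ := exists_schwartz_ofReal (hχ₂d.mul hΨ) (hχ₂c.mul_right (f' := Ψ))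
    have hH := hkill F₁ F₂ hF₁c (hF₁t.trans (tsupport_mul_subset_left.trans hχ₁U)) hF₂c
      (hF₂t.trans (tsupport_mul_subset_left.trans hχ₂V)) _ (isAppendTensorOf_appendTensor F₁ F₂)
    rw [← hH]
    congr 1
    funext x
    rw [SchwartzMap.appendTensor_apply, Function.comp_def, Function.comp_def, hF₁, hF₂, hf x]
    simp only [hχdef]
    push_cast
    ring
  -- hence every element of the generated subalgebra (= the linear span of the monoid `T`) is killed
  have hQspan : ∀ g ∈ Submodule.span ℝ ((Submonoid.closure T : Submonoid C(Fin (n + m) → E4, ℝ)) :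
      Set C(Fin (n + m) → E4, ℝ)), ∫ x, D x * (χ x * ((g x : ℝ) : ℂ)) = 0 := by
    intro g hg
    induction hg using Submodule.span_induction with
    | mem f hf => exact hQT f (hclT f hf)
    | zero => simp
    | add f f' _ _ hf hf' =>
      have heq : (fun x => D x * (χ x * (((f + f') x : ℝ) : ℂ))) =
          fun x => D x * (χ x * ((f x : ℝ) : ℂ)) + D x * (χ x * ((f' x : ℝ) : ℂ)) := by
        funext x
        rw [ContinuousMap.add_apply]
        push_cast
        ring
      rw [heq, integral_add (hint _ (by fun_prop)) (hint _ (by fun_prop)), hf, hf', add_zero]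
    | smul r f _ hf =>
      have heq : (fun x => D x * (χ x * (((r • f) x : ℝ) : ℂ))) =
          fun x => (r : ℂ) * (D x * (χ x * ((f x : ℝ) : ℂ))) := by
        funext x
        rw [ContinuousMap.smul_apply, smul_eq_mul]
        push_cast
        ring
      rw [heq, integral_const_mul, hf, mul_zero]
  have hQ : ∀ g ∈ Algebra.adjoin ℝ T, ∫ x, D x * (χ x * ((g x : ℝ) : ℂ)) = 0 := fun g hg =>
    hQspan g (by rw [← Algebra.adjoin_eq_span, Subalgebra.mem_toSubmodule]; exact hg)
  -- the `L¹` bound: `‖∫ D·K‖ ≤ 2ε ∫_X ‖D‖` for every `ε > 0`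
  set M : ℝ := ∫ x in X, ‖D x‖ with hMdef
  have hM0 : 0 ≤ M := setIntegral_nonneg hXc.measurableSet fun x _ => norm_nonneg _
  have key : ∀ ε : ℝ, 0 < ε → ‖∫ x, D x * K x‖ ≤ 2 * ε * M := by
    intro ε hε
    obtain ⟨g₁, hg₁A, hg₁⟩ :=
      ContinuousMap.exists_mem_subalgebra_near_continuous_of_isCompact_of_separatesPoints hsep
        ⟨fun x => (K x).re, Complex.continuous_re.comp K.continuous⟩ hXc hε
    obtain ⟨g₂, hg₂A, hg₂⟩ :=
      ContinuousMap.exists_mem_subalgebra_near_continuous_of_isCompact_of_separatesPoints hsep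
        ⟨fun x => (K x).im, Complex.continuous_im.comp K.continuous⟩ hXc hε
    -- the complex approximant `a = g₁ + i g₂` of `K` on `X`; `∫ D · χ · a = 0`
    set a : (Fin (n + m) → E4) → ℂ := fun x => ((g₁ x : ℝ) : ℂ) + ((g₂ x : ℝ) : ℂ) * Complex.I
      with hadef
    have hacont : Continuous a := by
      simp only [hadef]
      fun_prop
    have ha : ∫ x, D x * (χ x * a x) = 0 := by
      have heq : (fun x => D x * (χ x * a x)) =
          fun x => D x * (χ x * ((g₁ x : ℝ) : ℂ)) + D x * (χ x * ((g₂ x : ℝ) : ℂ)) * Complex.I := by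
        funext x
        simp only [hadef]
        ring
      rw [heq, integral_add (hint _ (by fun_prop)) ((hint _ (by fun_prop)).mul_const _),
        integral_mul_const, hQ g₁ hg₁A, hQ g₂ hg₂A]
      simp
    have hdiff : ∫ x, D x * K x = ∫ x, D x * (K x - χ x * a x) := by
      have heq : (fun x => D x * (K x - χ x * a x)) = fun x => D x * K x - D x * (χ x * a x) := by
        funext x
        ring
      rw [heq, integral_sub hKint (hint a hacont), ha, sub_zero]
    have hbound : ∀ x, ‖D x * (K x - χ x * a x)‖ ≤ X.indicator (fun x => 2 * ε * ‖D x‖) x := by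
      intro x
      by_cases hx : x ∈ X
      · rw [Set.indicator_of_mem hx, norm_mul]
        have hfac : K x - χ x * a x = χ x * (K x - a x) := by rw [mul_sub, hχK x]
        have hre : |(K x - a x).re| < ε := by
          have h := hg₁ x hx
          simp only [ContinuousMap.coe_mk, Real.norm_eq_abs] at h
          have : (K x - a x).re = (K x).re - g₁ x := by simp [hadef]
          rw [this, abs_sub_comm]
          exact h
        have him : |(K x - a x).im| < ε := by
          have h := hg₂ x hx
          simp only [ContinuousMap.coe_mk, Real.norm_eq_abs] at h
          have : (K x - a x).im = (K x).im - g₂ x := by simp [hadef]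
          rw [this, abs_sub_comm]
          exact h
        have hKa : ‖K x - a x‖ ≤ 2 * ε :=
          (Complex.norm_le_abs_re_add_abs_im _).trans (by linarith)
        rw [hfac, norm_mul]
        calc ‖D x‖ * (‖χ x‖ * ‖K x - a x‖) ≤ ‖D x‖ * (1 * (2 * ε)) := by
              gcongr
              exact hχ1 x
          _ = 2 * ε * ‖D x‖ := by ring
      · rw [Set.indicator_of_notMem hx, hKX x hx, hχ0 x hx]
        simp
    rw [hdiff]
    calc ‖∫ x, D x * (K x - χ x * a x)‖ ≤ ∫ x, X.indicator (fun x => 2 * ε * ‖D x‖) x :=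
          norm_integral_le_of_norm_le
            ((integrable_indicator_iff hXc.measurableSet).2 (hDX.norm.const_mul (2 * ε)))
            (Eventually.of_forall hbound)
      _ = 2 * ε * M := by rw [integral_indicator hXc.measurableSet, integral_const_mul]
  -- conclusion
  have h0 : ‖∫ x, D x * K x‖ ≤ 0 := by
    refine le_of_forall_pos_le_add fun δ hδ => ?_
    have h := key (δ / (2 * (M + 1))) (by positivity)
    have h' : 2 * (δ / (2 * (M + 1))) * M ≤ δ := by
      rw [show 2 * (δ / (2 * (M + 1))) * M = δ * (M / (M + 1)) by field_simp]
      calc δ * (M / (M + 1)) ≤ δ * 1 := by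
            gcongr
            exact (div_le_one (by linarith)).2 (by linarith)
        _ = δ := mul_one δ
    linarith
  exact norm_le_zero_iff.1 h0

end Summit.QuantumFields.YangMills.Theorems.CurvatureBoostCovariance.BoostsInheritMirrors

end
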